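import Summits.BirchSwinnertonDyer.BirchSwinnertonDyer.Theorems.BiquadraticEisensteinDescentHeegnerTwistCouplingInSupplyMonskyCells
import HarnessLib

set_option linter.dupNamespace false -- `Summit.BirchSwinnertonDyer.BirchSwinnertonDyer.Theorems.…` (summit = sub, D-0017)
set_option autoImplicit false

/-!
# Crux `HeegnerTwistCouplingInSupply` (stmt-BirchSwinnertonDyer-21381), card `class-number-switch-duke-bilinear` —
# the two Monsky cells of the `E_p` missing corner (`p ≡ 7 (mod 8)`): `ResidueCell` and `NonresidueCell`, PROVED

Route `BiquadraticEisensteinDescent` (cell `pub/bsd-wall`; width seat `bsd-wall-cm-bed-w4` g25; theorems only,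
`--supports 21381`). Kernel form of the two CELL statements of the crux idea card
`Cruxes/HeegnerTwistCouplingInSupply/Ideas/class-number-switch-duke-bilinear.md` (ideation seat 2, g27; desk sketch
`cruxidea-…-21381-2/g27/Sketch.lean`, defs `ResidueCell` / `NonresidueCell`):

* §2 `residueCell` — the card's `ResidueCell` («the cell `{(3,+),(5,−)}` is universal»): for primes `p ≡ 7`, `ℓ₃ ≡ 3`,
  `ℓ₅ ≡ 5 (mod 8)` with `(ℓ₅/p) = −1`, `det M(p, ℓ₃, ℓ₅) = 1` — ALREADY the tree theorem
  `…MonskyCells.det_monskyMatrixOdd_cell_seven_mod_eight` (lead `bsd-line-ibd-p1` g10), which does not even need the card's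
  hypothesis `(ℓ₃/p) = +1`; restated here in the card's binder order for the triage.
* §3 ★ `det_monskyMatrixOdd_nonresidueCell` — the card's `NonresidueCell` («the all-nonresidue cell `{(1,−),(3,−),(5,−)}` is
  invertible iff `(ℓ₁/ℓ₃) = +1, independently of (ℓ₅/ℓ₁), (ℓ₅/ℓ₃)`», IF direction): for primes `p ≡ 7`, `ℓ₁ ≡ 1`, `ℓ₃ ≡ 3`,
  `ℓ₅ ≡ 5 (mod 8)` with `(ℓ₁/p) = (ℓ₃/p) = (ℓ₅/p) = −1` and `(ℓ₁/ℓ₃) = +1`: `det M(p, ℓ₁, ℓ₃, ℓ₅) = 1` — four explicit `8 × 8`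
  matrices over `𝔽₂` (one per value of the free symbols `(ℓ₅/ℓ₁)`, `(ℓ₅/ℓ₃)`), each with an exhibited inverse.
* §4 ★ `det_monskyMatrixOdd_nonresidueCell_eq_zero` — the ONLY-IF direction: with `(ℓ₁/ℓ₃) = −1` instead, `det M = 0`
  (an explicit kernel vector in each of the four cases). With Monsky's theorem (`monsky_card_selmerGroup_two_odd`, named
  fact) `det M = 1 ⟺ #Sel₂(E_{pℓ₁ℓ₃ℓ₅}) = 4` (tree: `Smith2016.card_selmerGroup_two_eq_four_iff_det_monskyMatrixOdd`).

HONEST FRAMING: `𝔽₂`-linear algebra of Monsky's matrix only. The card's two SUPPLIES (DUKE-A: Duke–Iwaniec shrinking-disc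
equidistribution for `h(−4p) ≥ p^{1/2−η}`; HB95: the bilinear all-nonresidue triple) are print / XL facts NOT touched here;
no `L`-value is produced beyond what `…IndefinitePinCorner.cruxOnEpCorner_of_facts` already does modulo its named facts;
crux 21381 and BSD are NOT proved. No definition, no named fact, no `sorry`; axioms standard.
[cite: HeathBrown1994SelmerCongruentII, Appendix (Monsky), typescript p. 39 L10–L33 (the matrix; evaluation ours)]
-/

namespace Summit.BirchSwinnertonDyer.BirchSwinnertonDyer.Theorems.DukeBilinearCells

open Matrix Literature.NumberTheory.EllipticCurves Literature.NumberTheory.EllipticCurves.HeathBrown1994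
  Literature.NumberTheory.EllipticCurves.HeathBrown1994.Families
open Summit.BirchSwinnertonDyer.BirchSwinnertonDyer.Theorems.BiquadraticEisensteinDescentHeegnerTwistCouplingInSupplyMonskyCells

/-! ## §1 Tools: Monsky's `A` and `D_a` for four primes, written out -/

/-- Monsky's `A` for a four-term vector, written out: off-diagonal entries the additive symbols `[(p_j/p_i) ≠ 1]`, diagonal
entries the row sums. [cite: HeathBrown1994SelmerCongruentII, Appendix (Monsky), typescript p. 39 L13–L26] -/
theorem legendreMatrix_four (p q l r : ℕ) :
    legendreMatrix ![p, q, l, r] =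
      !![addLegendreSym q p + addLegendreSym l p + addLegendreSym r p, addLegendreSym q p, addLegendreSym l p,
            addLegendreSym r p;
         addLegendreSym p q, addLegendreSym p q + addLegendreSym l q + addLegendreSym r q, addLegendreSym l q,
            addLegendreSym r q;
         addLegendreSym p l, addLegendreSym q l, addLegendreSym p l + addLegendreSym q l + addLegendreSym r l,
            addLegendreSym r l;
         addLegendreSym p r, addLegendreSym q r, addLegendreSym l r,
            addLegendreSym p r + addLegendreSym q r + addLegendreSym l r] := by
  ext i j
  fin_cases i <;> fin_cases j <;> simp [legendreMatrix, Fin.sum_univ_four] <;> ring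

/-- Monsky's diagonal `D_a` for a four-term vector, written out.
[cite: HeathBrown1994SelmerCongruentII, Appendix (Monsky), typescript p. 39 L10–L13] -/
theorem legendreDiagonal_four (p q l r : ℕ) (a : ℤ) :
    legendreDiagonal ![p, q, l, r] a =
      !![addLegendreSym a p, 0, 0, 0; 0, addLegendreSym a q, 0, 0; 0, 0, addLegendreSym a l, 0;
         0, 0, 0, addLegendreSym a r] := by
  ext i j
  fin_cases i <;> fin_cases j <;> simp [legendreDiagonal, Matrix.diagonal]

/-- Over `𝔽₂`, a matrix with a non-zero kernel vector has determinant `0`. [folklore] -/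
theorem det_eq_zero_of_mulVec_eq_zero {ι : Type*} [Fintype ι] [DecidableEq ι] (M : Matrix ι ι (ZMod 2))
    (v : ι → ZMod 2) (hv : v ≠ 0) (h : M *ᵥ v = 0) : M.det = 0 :=
  Matrix.exists_mulVec_eq_zero_iff.mp ⟨v, hv, h⟩

/-! ## §2 The residue cell `{(3,+),(5,−)}` (already in the tree) -/

section Cells

variable {p ℓ₁ ℓ₃ ℓ₅ : ℕ}

/-- **The card's `ResidueCell`, verbatim binder order** — `p ≡ 7`, `ℓ₃ ≡ 3`, `ℓ₅ ≡ 5 (mod 8)` primes, `(ℓ₃/p) = +1`,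
`(ℓ₅/p) = −1` ⟹ `det M(p, ℓ₃, ℓ₅) = 1`: this is the tree's `det_monskyMatrixOdd_cell_seven_mod_eight` (which holds for
both values of `(ℓ₃/p)`; the hypothesis `(ℓ₃/p) = +1` is idle and kept only to match the card).
[cite: HeathBrown1994SelmerCongruentII, Appendix (Monsky), typescript p. 39 L27–L33 (the matrix; evaluation ours)] -/
theorem residueCell (hp : p.Prime) (h₃ : ℓ₃.Prime) (h₅ : ℓ₅.Prime) (hp8 : p % 8 = 7) (h38 : ℓ₃ % 8 = 3)
    (h58 : ℓ₅ % 8 = 5) (_h3p : jacobiSym (ℓ₃ : ℤ) p = 1) (h5p : jacobiSym (ℓ₅ : ℤ) p = -1) :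
    (monskyMatrixOdd ![p, ℓ₃, ℓ₅]).det = 1 :=
  det_monskyMatrixOdd_cell_seven_mod_eight hp h₃ h₅ hp8 h38 h58 h5p

/-! ## §3 The all-nonresidue cell `{(1,−),(3,−),(5,−)}`: invertible when `(ℓ₁/ℓ₃) = +1` -/

/-- Symbol bookkeeping for `(p, ℓ₁, ℓ₃, ℓ₅)` with `p ≡ 7`, `ℓ₁ ≡ 1`, `ℓ₃ ≡ 3`, `ℓ₅ ≡ 5 (mod 8)` (no primality needed):
reciprocity `(p/ℓ₁) = (ℓ₁/p)`, `(p/ℓ₃) = −(ℓ₃/p)`, `(p/ℓ₅) = (ℓ₅/p)`, `(ℓ₃/ℓ₁) = (ℓ₁/ℓ₃)`, `(ℓ₁/ℓ₅) = (ℓ₅/ℓ₁)`,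
`(ℓ₃/ℓ₅) = (ℓ₅/ℓ₃)`; supplements `(2/p) = (2/ℓ₁) = +1`, `(2/ℓ₃) = (2/ℓ₅) = −1`, `(−2/p) = (−2/ℓ₅) = −1`,
`(−2/ℓ₁) = (−2/ℓ₃) = +1`. [folklore] -/
theorem symbols_of_quadruple (hp8 : p % 8 = 7) (h18 : ℓ₁ % 8 = 1) (h38 : ℓ₃ % 8 = 3) (h58 : ℓ₅ % 8 = 5) :
    jacobiSym (p : ℤ) ℓ₁ = jacobiSym (ℓ₁ : ℤ) p ∧ jacobiSym (p : ℤ) ℓ₃ = -jacobiSym (ℓ₃ : ℤ) p ∧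
      jacobiSym (p : ℤ) ℓ₅ = jacobiSym (ℓ₅ : ℤ) p ∧ jacobiSym (ℓ₃ : ℤ) ℓ₁ = jacobiSym (ℓ₁ : ℤ) ℓ₃ ∧
      jacobiSym (ℓ₁ : ℤ) ℓ₅ = jacobiSym (ℓ₅ : ℤ) ℓ₁ ∧ jacobiSym (ℓ₃ : ℤ) ℓ₅ = jacobiSym (ℓ₅ : ℤ) ℓ₃ ∧
      jacobiSym 2 p = 1 ∧ jacobiSym 2 ℓ₁ = 1 ∧ jacobiSym 2 ℓ₃ = -1 ∧ jacobiSym 2 ℓ₅ = -1 ∧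
      jacobiSym (-2) p = -1 ∧ jacobiSym (-2) ℓ₁ = 1 ∧ jacobiSym (-2) ℓ₃ = 1 ∧ jacobiSym (-2) ℓ₅ = -1 :=
  ⟨jacobiSym.quadratic_reciprocity_one_mod_four' (Nat.odd_iff.mpr (by omega)) (by omega),
    jacobiSym.quadratic_reciprocity_three_mod_four (by omega) (by omega),
    jacobiSym.quadratic_reciprocity_one_mod_four' (Nat.odd_iff.mpr (by omega)) (by omega),
    jacobiSym.quadratic_reciprocity_one_mod_four' (Nat.odd_iff.mpr (by omega)) (by omega),
    jacobiSym.quadratic_reciprocity_one_mod_four' (Nat.odd_iff.mpr (by omega)) (by omega),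
    jacobiSym.quadratic_reciprocity_one_mod_four' (Nat.odd_iff.mpr (by omega)) (by omega),
    jacobiSym_two_eq_one (Or.inr hp8), jacobiSym_two_eq_one (Or.inl h18),
    jacobiSym_two_eq_neg_one (Or.inl h38), jacobiSym_two_eq_neg_one (Or.inr h58),
    jacobiSym_neg_two_eq_neg_one (Or.inr hp8), jacobiSym_neg_two_eq_one (Or.inl h18),
    jacobiSym_neg_two_eq_one (Or.inr h38), jacobiSym_neg_two_eq_neg_one (Or.inl h58)⟩

/-- ★ **The card's `NonresidueCell` (IF direction): `det M(p, ℓ₁, ℓ₃, ℓ₅) = 1`** for primes `p ≡ 7`, `ℓ₁ ≡ 1`, `ℓ₃ ≡ 3`,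
`ℓ₅ ≡ 5 (mod 8)` with `(ℓ₁/p) = (ℓ₃/p) = (ℓ₅/p) = −1` and `(ℓ₁/ℓ₃) = +1`, for all four values of the free symbols
`(ℓ₅/ℓ₁)`, `(ℓ₅/ℓ₃)`: four explicit `8 × 8` matrices over `𝔽₂`, each with an exhibited inverse (so, by Monsky's theorem,
`#Sel₂(E_{pℓ₁ℓ₃ℓ₅}) = 4`). [cite: HeathBrown1994SelmerCongruentII, Appendix (Monsky), typescript p. 39 L27–L33 (the matrix; evaluation ours)] -/
theorem det_monskyMatrixOdd_nonresidueCell (_hp : p.Prime) (h₁ : ℓ₁.Prime) (h₃ : ℓ₃.Prime) (h₅ : ℓ₅.Prime)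
    (hp8 : p % 8 = 7) (h18 : ℓ₁ % 8 = 1) (h38 : ℓ₃ % 8 = 3) (h58 : ℓ₅ % 8 = 5)
    (h1p : jacobiSym (ℓ₁ : ℤ) p = -1) (h3p : jacobiSym (ℓ₃ : ℤ) p = -1) (h5p : jacobiSym (ℓ₅ : ℤ) p = -1)
    (h13 : jacobiSym (ℓ₁ : ℤ) ℓ₃ = 1) :
    (monskyMatrixOdd ![p, ℓ₁, ℓ₃, ℓ₅]).det = 1 := by
  obtain ⟨hp1, hp3, hp5, h31, h15, h35, h2p, h21, h23, h25, hm2p, hm21, hm23, hm25⟩ :=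
    symbols_of_quadruple (ℓ₁ := ℓ₁) (ℓ₃ := ℓ₃) (ℓ₅ := ℓ₅) hp8 h18 h38 h58
  rw [h1p] at hp1
  rw [h3p, neg_neg] at hp3
  rw [h5p] at hp5
  rw [h13] at h31
  -- the fixed additive symbols
  have a_1p : addLegendreSym (ℓ₁ : ℤ) p = 1 := addLegendreSym_of_eq_neg_one h1p
  have a_3p : addLegendreSym (ℓ₃ : ℤ) p = 1 := addLegendreSym_of_eq_neg_one h3p
  have a_5p : addLegendreSym (ℓ₅ : ℤ) p = 1 := addLegendreSym_of_eq_neg_one h5p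
  have a_p1 : addLegendreSym (p : ℤ) ℓ₁ = 1 := addLegendreSym_of_eq_neg_one hp1
  have a_p3 : addLegendreSym (p : ℤ) ℓ₃ = 0 := addLegendreSym_of_eq_one hp3
  have a_p5 : addLegendreSym (p : ℤ) ℓ₅ = 1 := addLegendreSym_of_eq_neg_one hp5
  have a_13 : addLegendreSym (ℓ₁ : ℤ) ℓ₃ = 0 := addLegendreSym_of_eq_one h13
  have a_31 : addLegendreSym (ℓ₃ : ℤ) ℓ₁ = 0 := addLegendreSym_of_eq_one h31
  have d2p : addLegendreSym 2 p = 0 := addLegendreSym_of_eq_one h2p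
  have d21 : addLegendreSym 2 ℓ₁ = 0 := addLegendreSym_of_eq_one h21
  have d23 : addLegendreSym 2 ℓ₃ = 1 := addLegendreSym_of_eq_neg_one h23
  have d25 : addLegendreSym 2 ℓ₅ = 1 := addLegendreSym_of_eq_neg_one h25
  have dm2p : addLegendreSym (-2) p = 1 := addLegendreSym_of_eq_neg_one hm2p
  have dm21 : addLegendreSym (-2) ℓ₁ = 0 := addLegendreSym_of_eq_one hm21
  have dm23 : addLegendreSym (-2) ℓ₃ = 0 := addLegendreSym_of_eq_one hm23
  have dm25 : addLegendreSym (-2) ℓ₅ = 1 := addLegendreSym_of_eq_neg_one hm25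
  have h51_ne : ℓ₅ ≠ ℓ₁ := by rintro rfl; omega
  have h53_ne : ℓ₅ ≠ ℓ₃ := by rintro rfl; omega
  -- the two free symbols `(ℓ₅/ℓ₁)`, `(ℓ₅/ℓ₃)`
  rcases jacobiSym.eq_one_or_neg_one (int_gcd_eq_one_of_primes h₅ h₁ h51_ne) with h51 | h51 <;>
    rw [h51] at h15 <;>
    rcases jacobiSym.eq_one_or_neg_one (int_gcd_eq_one_of_primes h₅ h₃ h53_ne) with h53 | h53 <;> rw [h53] at h35
  · -- (ℓ₅/ℓ₁) = 1, (ℓ₅/ℓ₃) = 1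
    have a_51 : addLegendreSym (ℓ₅ : ℤ) ℓ₁ = 0 := addLegendreSym_of_eq_one h51
    have a_15 : addLegendreSym (ℓ₁ : ℤ) ℓ₅ = 0 := addLegendreSym_of_eq_one h15
    have a_53 : addLegendreSym (ℓ₅ : ℤ) ℓ₃ = 0 := addLegendreSym_of_eq_one h53
    have a_35 : addLegendreSym (ℓ₃ : ℤ) ℓ₅ = 0 := addLegendreSym_of_eq_one h35
    rw [monskyMatrixOdd, legendreMatrix_four, legendreDiagonal_four, legendreDiagonal_four,
      a_1p, a_3p, a_5p, a_p1, a_p3, a_p5, a_13, a_31, a_51, a_15, a_53, a_35,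
      d2p, d21, d23, d25, dm2p, dm21, dm23, dm25]
    exact det_eq_one_of_mul_eq_one _ (Matrix.fromBlocks
      !![1, 1, 1, 1; 1, 0, 1, 1; 0, 0, 0, 0; 1, 1, 0, 0] !![1, 1, 0, 1; 1, 1, 0, 1; 0, 0, 1, 0; 0, 0, 1, 0]
      !![1, 1, 0, 0; 1, 1, 0, 0; 0, 0, 1, 0; 1, 1, 1, 0] !![0, 0, 1, 1; 0, 1, 1, 1; 0, 0, 1, 0; 1, 1, 0, 1]) (by decide)
  · -- (ℓ₅/ℓ₁) = 1, (ℓ₅/ℓ₃) = -1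
    have a_51 : addLegendreSym (ℓ₅ : ℤ) ℓ₁ = 0 := addLegendreSym_of_eq_one h51
    have a_15 : addLegendreSym (ℓ₁ : ℤ) ℓ₅ = 0 := addLegendreSym_of_eq_one h15
    have a_53 : addLegendreSym (ℓ₅ : ℤ) ℓ₃ = 1 := addLegendreSym_of_eq_neg_one h53
    have a_35 : addLegendreSym (ℓ₃ : ℤ) ℓ₅ = 1 := addLegendreSym_of_eq_neg_one h35
    rw [monskyMatrixOdd, legendreMatrix_four, legendreDiagonal_four, legendreDiagonal_four,
      a_1p, a_3p, a_5p, a_p1, a_p3, a_p5, a_13, a_31, a_51, a_15, a_53, a_35,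
      d2p, d21, d23, d25, dm2p, dm21, dm23, dm25]
    exact det_eq_one_of_mul_eq_one _ (Matrix.fromBlocks
      !![0, 0, 1, 1; 0, 1, 1, 1; 1, 1, 0, 0; 0, 0, 0, 0] !![0, 0, 1, 0; 0, 0, 1, 0; 1, 1, 0, 1; 1, 1, 0, 1]
      !![1, 1, 0, 0; 1, 1, 0, 0; 0, 0, 1, 0; 1, 1, 1, 0] !![0, 0, 1, 1; 0, 1, 1, 1; 1, 1, 0, 1; 0, 0, 1, 0]) (by decide)
  · -- (ℓ₅/ℓ₁) = -1, (ℓ₅/ℓ₃) = 1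
    have a_51 : addLegendreSym (ℓ₅ : ℤ) ℓ₁ = 1 := addLegendreSym_of_eq_neg_one h51
    have a_15 : addLegendreSym (ℓ₁ : ℤ) ℓ₅ = 1 := addLegendreSym_of_eq_neg_one h15
    have a_53 : addLegendreSym (ℓ₅ : ℤ) ℓ₃ = 0 := addLegendreSym_of_eq_one h53
    have a_35 : addLegendreSym (ℓ₃ : ℤ) ℓ₅ = 0 := addLegendreSym_of_eq_one h35
    rw [monskyMatrixOdd, legendreMatrix_four, legendreDiagonal_four, legendreDiagonal_four,
      a_1p, a_3p, a_5p, a_p1, a_p3, a_p5, a_13, a_31, a_51, a_15, a_53, a_35,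
      d2p, d21, d23, d25, dm2p, dm21, dm23, dm25]
    exact det_eq_one_of_mul_eq_one _ (Matrix.fromBlocks
      !![1, 1, 1, 1; 1, 1, 0, 0; 0, 0, 0, 0; 1, 0, 1, 1] !![1, 1, 0, 1; 0, 0, 1, 0; 0, 0, 1, 0; 1, 1, 0, 1]
      !![1, 0, 0, 1; 1, 0, 1, 1; 0, 0, 1, 0; 1, 0, 0, 1] !![0, 1, 1, 0; 1, 0, 0, 0; 0, 0, 1, 0; 0, 0, 1, 0]) (by decide)
  · -- (ℓ₅/ℓ₁) = -1, (ℓ₅/ℓ₃) = -1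
    have a_51 : addLegendreSym (ℓ₅ : ℤ) ℓ₁ = 1 := addLegendreSym_of_eq_neg_one h51
    have a_15 : addLegendreSym (ℓ₁ : ℤ) ℓ₅ = 1 := addLegendreSym_of_eq_neg_one h15
    have a_53 : addLegendreSym (ℓ₅ : ℤ) ℓ₃ = 1 := addLegendreSym_of_eq_neg_one h53
    have a_35 : addLegendreSym (ℓ₃ : ℤ) ℓ₅ = 1 := addLegendreSym_of_eq_neg_one h35
    rw [monskyMatrixOdd, legendreMatrix_four, legendreDiagonal_four, legendreDiagonal_four,
      a_1p, a_3p, a_5p, a_p1, a_p3, a_p5, a_13, a_31, a_51, a_15, a_53, a_35,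
      d2p, d21, d23, d25, dm2p, dm21, dm23, dm25]
    exact det_eq_one_of_mul_eq_one _ (Matrix.fromBlocks
      !![0, 1, 0, 0; 0, 1, 1, 1; 1, 0, 1, 1; 0, 0, 0, 0] !![1, 1, 0, 1; 0, 0, 1, 0; 0, 0, 1, 0; 1, 1, 0, 1]
      !![1, 0, 0, 1; 1, 0, 1, 1; 0, 0, 1, 0; 1, 0, 0, 1] !![1, 0, 0, 1; 1, 0, 0, 0; 1, 1, 0, 1; 1, 1, 0, 1]) (by decide)

/-! ## §4 … and singular when `(ℓ₁/ℓ₃) = −1` (the ONLY-IF direction) -/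

/-- ★ **`NonresidueCell`, ONLY-IF direction: `det M(p, ℓ₁, ℓ₃, ℓ₅) = 0` when `(ℓ₁/ℓ₃) = −1`** (same residues and
`(ℓᵢ/p) = −1`), for all four values of `(ℓ₅/ℓ₁)`, `(ℓ₅/ℓ₃)`: an explicit non-zero kernel vector in each case (so, by
Monsky's theorem, `#Sel₂(E_{pℓ₁ℓ₃ℓ₅}) > 4`: the bilinear condition `(ℓ₁/ℓ₃) = +1` of the card's Case B is NECESSARY).
[cite: HeathBrown1994SelmerCongruentII, Appendix (Monsky), typescript p. 39 L27–L33 (the matrix; evaluation ours)] -/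
theorem det_monskyMatrixOdd_nonresidueCell_eq_zero (_hp : p.Prime) (h₁ : ℓ₁.Prime) (h₃ : ℓ₃.Prime) (h₅ : ℓ₅.Prime)
    (hp8 : p % 8 = 7) (h18 : ℓ₁ % 8 = 1) (h38 : ℓ₃ % 8 = 3) (h58 : ℓ₅ % 8 = 5)
    (h1p : jacobiSym (ℓ₁ : ℤ) p = -1) (h3p : jacobiSym (ℓ₃ : ℤ) p = -1) (h5p : jacobiSym (ℓ₅ : ℤ) p = -1)
    (h13 : jacobiSym (ℓ₁ : ℤ) ℓ₃ = -1) :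
    (monskyMatrixOdd ![p, ℓ₁, ℓ₃, ℓ₅]).det = 0 := by
  obtain ⟨hp1, hp3, hp5, h31, h15, h35, h2p, h21, h23, h25, hm2p, hm21, hm23, hm25⟩ :=
    symbols_of_quadruple (ℓ₁ := ℓ₁) (ℓ₃ := ℓ₃) (ℓ₅ := ℓ₅) hp8 h18 h38 h58
  rw [h1p] at hp1
  rw [h3p, neg_neg] at hp3
  rw [h5p] at hp5
  rw [h13] at h31
  have a_1p : addLegendreSym (ℓ₁ : ℤ) p = 1 := addLegendreSym_of_eq_neg_one h1p
  have a_3p : addLegendreSym (ℓ₃ : ℤ) p = 1 := addLegendreSym_of_eq_neg_one h3p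
  have a_5p : addLegendreSym (ℓ₅ : ℤ) p = 1 := addLegendreSym_of_eq_neg_one h5p
  have a_p1 : addLegendreSym (p : ℤ) ℓ₁ = 1 := addLegendreSym_of_eq_neg_one hp1
  have a_p3 : addLegendreSym (p : ℤ) ℓ₃ = 0 := addLegendreSym_of_eq_one hp3
  have a_p5 : addLegendreSym (p : ℤ) ℓ₅ = 1 := addLegendreSym_of_eq_neg_one hp5
  have a_13 : addLegendreSym (ℓ₁ : ℤ) ℓ₃ = 1 := addLegendreSym_of_eq_neg_one h13
  have a_31 : addLegendreSym (ℓ₃ : ℤ) ℓ₁ = 1 := addLegendreSym_of_eq_neg_one h31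
  have d2p : addLegendreSym 2 p = 0 := addLegendreSym_of_eq_one h2p
  have d21 : addLegendreSym 2 ℓ₁ = 0 := addLegendreSym_of_eq_one h21
  have d23 : addLegendreSym 2 ℓ₃ = 1 := addLegendreSym_of_eq_neg_one h23
  have d25 : addLegendreSym 2 ℓ₅ = 1 := addLegendreSym_of_eq_neg_one h25
  have dm2p : addLegendreSym (-2) p = 1 := addLegendreSym_of_eq_neg_one hm2p
  have dm21 : addLegendreSym (-2) ℓ₁ = 0 := addLegendreSym_of_eq_one hm21
  have dm23 : addLegendreSym (-2) ℓ₃ = 0 := addLegendreSym_of_eq_one hm23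
  have dm25 : addLegendreSym (-2) ℓ₅ = 1 := addLegendreSym_of_eq_neg_one hm25
  have h51_ne : ℓ₅ ≠ ℓ₁ := by rintro rfl; omega
  have h53_ne : ℓ₅ ≠ ℓ₃ := by rintro rfl; omega
  rcases jacobiSym.eq_one_or_neg_one (int_gcd_eq_one_of_primes h₅ h₁ h51_ne) with h51 | h51 <;>
    rw [h51] at h15 <;>
    rcases jacobiSym.eq_one_or_neg_one (int_gcd_eq_one_of_primes h₅ h₃ h53_ne) with h53 | h53 <;> rw [h53] at h35
  · -- (ℓ₅/ℓ₁) = 1, (ℓ₅/ℓ₃) = 1: kernel vector (0,1,0,1 | 1,1,1,0)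
    have a_51 : addLegendreSym (ℓ₅ : ℤ) ℓ₁ = 0 := addLegendreSym_of_eq_one h51
    have a_15 : addLegendreSym (ℓ₁ : ℤ) ℓ₅ = 0 := addLegendreSym_of_eq_one h15
    have a_53 : addLegendreSym (ℓ₅ : ℤ) ℓ₃ = 0 := addLegendreSym_of_eq_one h53
    have a_35 : addLegendreSym (ℓ₃ : ℤ) ℓ₅ = 0 := addLegendreSym_of_eq_one h35
    rw [monskyMatrixOdd, legendreMatrix_four, legendreDiagonal_four, legendreDiagonal_four,
      a_1p, a_3p, a_5p, a_p1, a_p3, a_p5, a_13, a_31, a_51, a_15, a_53, a_35,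
      d2p, d21, d23, d25, dm2p, dm21, dm23, dm25]
    exact det_eq_zero_of_mulVec_eq_zero _ (Sum.elim ![0, 1, 0, 1] ![1, 1, 1, 0]) (by decide) (by decide)
  · -- (ℓ₅/ℓ₁) = 1, (ℓ₅/ℓ₃) = -1: kernel vector (0,1,0,1 | 0,1,0,1)
    have a_51 : addLegendreSym (ℓ₅ : ℤ) ℓ₁ = 0 := addLegendreSym_of_eq_one h51
    have a_15 : addLegendreSym (ℓ₁ : ℤ) ℓ₅ = 0 := addLegendreSym_of_eq_one h15
    have a_53 : addLegendreSym (ℓ₅ : ℤ) ℓ₃ = 1 := addLegendreSym_of_eq_neg_one h53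
    have a_35 : addLegendreSym (ℓ₃ : ℤ) ℓ₅ = 1 := addLegendreSym_of_eq_neg_one h35
    rw [monskyMatrixOdd, legendreMatrix_four, legendreDiagonal_four, legendreDiagonal_four,
      a_1p, a_3p, a_5p, a_p1, a_p3, a_p5, a_13, a_31, a_51, a_15, a_53, a_35,
      d2p, d21, d23, d25, dm2p, dm21, dm23, dm25]
    exact det_eq_zero_of_mulVec_eq_zero _ (Sum.elim ![0, 1, 0, 1] ![0, 1, 0, 1]) (by decide) (by decide)
  · -- (ℓ₅/ℓ₁) = -1, (ℓ₅/ℓ₃) = 1: kernel vector (0,1,0,1 | 0,1,1,0)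
    have a_51 : addLegendreSym (ℓ₅ : ℤ) ℓ₁ = 1 := addLegendreSym_of_eq_neg_one h51
    have a_15 : addLegendreSym (ℓ₁ : ℤ) ℓ₅ = 1 := addLegendreSym_of_eq_neg_one h15
    have a_53 : addLegendreSym (ℓ₅ : ℤ) ℓ₃ = 0 := addLegendreSym_of_eq_one h53
    have a_35 : addLegendreSym (ℓ₃ : ℤ) ℓ₅ = 0 := addLegendreSym_of_eq_one h35
    rw [monskyMatrixOdd, legendreMatrix_four, legendreDiagonal_four, legendreDiagonal_four,
      a_1p, a_3p, a_5p, a_p1, a_p3, a_p5, a_13, a_31, a_51, a_15, a_53, a_35,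
      d2p, d21, d23, d25, dm2p, dm21, dm23, dm25]
    exact det_eq_zero_of_mulVec_eq_zero _ (Sum.elim ![0, 1, 0, 1] ![0, 1, 1, 0]) (by decide) (by decide)
  · -- (ℓ₅/ℓ₁) = -1, (ℓ₅/ℓ₃) = -1: kernel vector (0,1,0,1 | 0,1,0,1)
    have a_51 : addLegendreSym (ℓ₅ : ℤ) ℓ₁ = 1 := addLegendreSym_of_eq_neg_one h51
    have a_15 : addLegendreSym (ℓ₁ : ℤ) ℓ₅ = 1 := addLegendreSym_of_eq_neg_one h15
    have a_53 : addLegendreSym (ℓ₅ : ℤ) ℓ₃ = 1 := addLegendreSym_of_eq_neg_one h53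
    have a_35 : addLegendreSym (ℓ₃ : ℤ) ℓ₅ = 1 := addLegendreSym_of_eq_neg_one h35
    rw [monskyMatrixOdd, legendreMatrix_four, legendreDiagonal_four, legendreDiagonal_four,
      a_1p, a_3p, a_5p, a_p1, a_p3, a_p5, a_13, a_31, a_51, a_15, a_53, a_35,
      d2p, d21, d23, d25, dm2p, dm21, dm23, dm25]
    exact det_eq_zero_of_mulVec_eq_zero _ (Sum.elim ![0, 1, 0, 1] ![0, 1, 0, 1]) (by decide) (by decide)

/-- **The card's `NonresidueCell`, verbatim binder order** (IF direction, = `det_monskyMatrixOdd_nonresidueCell`).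
[cite: HeathBrown1994SelmerCongruentII, Appendix (Monsky), typescript p. 39 L27–L33 (the matrix; evaluation ours)] -/
theorem nonresidueCell : ∀ p ℓ₁ ℓ₃ ℓ₅ : ℕ, p.Prime → ℓ₁.Prime → ℓ₃.Prime → ℓ₅.Prime → p % 8 = 7 →
    ℓ₁ % 8 = 1 → ℓ₃ % 8 = 3 → ℓ₅ % 8 = 5 →
    jacobiSym ℓ₁ p = -1 → jacobiSym ℓ₃ p = -1 → jacobiSym ℓ₅ p = -1 → jacobiSym ℓ₁ ℓ₃ = 1 →
    (monskyMatrixOdd ![p, ℓ₁, ℓ₃, ℓ₅]).det = 1 :=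
  fun _ _ _ _ hp h₁ h₃ h₅ hp8 h18 h38 h58 h1p h3p h5p h13 =>
    det_monskyMatrixOdd_nonresidueCell hp h₁ h₃ h₅ hp8 h18 h38 h58 h1p h3p h5p h13

end Cells

end Summit.BirchSwinnertonDyer.BirchSwinnertonDyer.Theorems.DukeBilinearCells
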